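import Literature.NumberTheory.EllipticCurves.EichlerShimuraPeriods
import Literature.NumberTheory.EllipticCurves.HeckeOperatorsGamma1QExpansionProofs
import Literature.NumberTheory.EllipticCurves.HeckeOperatorsDiamondCommProofs
import HarnessLib

/-!
# Eichler–Shimura periods on `S_k(Γ₁(N))`, `k ≥ 2`: a finitely generated, Hecke- and
# diamond-stable, separating lattice of period functionals

This is the level-`Γ₁(N)` companion of
`Literature.NumberTheory.EllipticCurves.EichlerShimuraPeriods` (level `Γ₀(N)`). For every level
`N` and weight `k = n + 2 ≥ 2` it supplies the integral structure of Shimura 1971, (3.5.20)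
(*"a discrete `ℤ`-submodule of `S_k(Γ')` of maximal rank stable under the `[Γ'αΓ']_k`"*, stated
for every `Γ'` of type (3.3.2), in particular `Γ' = Γ₁(N)`, and proved in §8.4 from the
Eichler–Shimura isomorphism, Thm. 8.4, its Hecke equivariance, Prop. 8.5, and the integral
parabolic cohomology, Prop. 8.6) in the dual form used for the integrality of Hecke eigenvalues:
the subgroup `periodLatticeK1 n` of `S_{n+2}(Γ₁(N))^∧` generated by the period functionals
`f ↦ c_f(σ)(u, v)` for `σ ∈ Γ₀(N)` (sic) and `(u, v) ∈ ℤ²` is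

* finitely generated (`periodLatticeK1_fg`),
* stable under the transposes of the diamond operators `⟨d⟩` (`dualMap_diamondOp_mem_periodLatticeK1`)
  and of the Hecke operators `T_p`, `p` prime, `U_p` for `p ∣ N` included
  (`dualMap_heckeT_mem_periodLatticeK1`),
* separating (`eq_zero_of_forall_mem_periodLatticeK1`),

see `periodLatticeK1_fg_stable_separating`. Everything is proved.

## What changes at level `Γ₁(N)`

A form `f ∈ S_k(Γ₁(N))` is not invariant under `σ ∈ Γ₀(N)`; instead `f ∣ σ = ⟨σ⟩ f`
(`coe_diamondOp_eq_slash`). We nevertheless take periods over all of `Γ₀(N)`: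
`c_f(σ)(p) = ∫_τ^{i∞} (f|σ)(z)(zv-u)ⁿ dz - ∫_{στ}^{i∞} f(z)(zv'-u')ⁿ dz` (`periodFn1`, the same
formula as at level `Γ₀(N)`, meaningful for every `σ ∈ SL(2, ℤ)`), because

* the cocycle relation becomes `c_f(σδ)(p) = c_{⟨σ⟩f}(δ)(p) + c_f(σ)(δp)` (`periodFn1_mul`), so
  that `⟨d⟩^∨ λ_{δ,q} = λ_{σ_d δ, q} - λ_{σ_d, δ q}` (`dualMap_diamondOp_periodFunctionalK1`):
  diamond stability is free, and finite generation follows from that of `Γ₀(N)` and the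
  finiteness of `(ℤ/Nℤ)ˣ` (`periodLatticeK1_fg`);
* for `T_p` we use the upper-triangular representatives `βᵢ` of
  `Γ₀(N)\Γ₀(N) diag(1,p) Γ₀(N)` (`heckeRep`) with the twist `T_p f = ∑ᵢ (⟨εᵢ⟩ f) ∣ βᵢ`,
  `ε_j = 1`, `ε_∞ = p` (`coe_heckeT_gamma1`; Diamond–Shurman Prop. 5.2.1 and p. 172:
  `f[β_∞] = (⟨p⟩f)[diag(p,1)]`), and the right action `βᵢ σ = σ'ᵢ β_{π(i)}` of `σ ∈ Γ₀(N)` of the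
  level-`Γ₀(N)` file (`heckePermElt`, `heckePerm`), together with the congruence
  `ε_{π(i)} σ ≡ εᵢ σ'ᵢ` of lower-right entries mod `N` (`heckeEps_perm`); the result is
  `T_p^∨ λ_{σ,q} = ∑ᵢ ⟨εᵢ⟩^∨ λ_{σ'ᵢ, β_{π(i)} q}` (`dualMap_heckeT_periodFunctionalK1`, Shimura's
  (8.3.2));
* separation only uses periods over `Γ₁(N)`: if they vanish, the Eichler integral is a modular
  form of weight `-n ≤ 0` on `Γ₁(N)`, hence constant (`eq_zero_of_forall_periodFn1_eq_zero`).

All the analysis (kernels `∫_τ^{i∞} φ(z)(zv-u)ⁿ dz` of cusp functions, the transformation law,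
decay, the polynomial lemmas) is imported from the level-`Γ₀(N)` file.

## References

* G. Shimura, *Introduction to the arithmetic theory of automorphic functions*, Iwanami Shoten /
  Princeton UP, 1971: (3.3.2), Thm. 3.48 and (3.5.20) (pp. 83–84); §8.1–8.2 ((8.2.12)–(8.2.20),
  Thm. 8.4, pp. 230–234); §8.3 ((8.3.2), Prop. 8.5, pp. 236–238); §8.4 (Prop. 8.6, pp. 239–241).
* F. Diamond, J. Shurman, *A first course in modular forms*, GTM 228, Springer 2005, §5.2
  (Prop. 5.2.1, (5.2), p. 172), §6.5 (p. 237: `T_p` and `⟨d⟩` act on `H₁(X₁(N), ℤ)`).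
* P. Deligne, J.-P. Serre, *Formes modulaires de poids 1*, Ann. Sci. ÉNS (4) 7 (1974), 507–530,
  Rem. 2.8 (the case `k ≥ 2` of Prop. 2.7 via Shimura).
-/

noncomputable section

open scoped MatrixGroups ModularForm Topology Manifold

open CongruenceSubgroup Complex MeasureTheory Set Filter Function
open UpperHalfPlane hiding I

namespace Literature.NumberTheory.EllipticCurves.ModularForms

/-! ### Cusp forms of level `Γ₁(N)` and their `SL(2, ℤ)`-translates are cusp functions -/

section CuspFunction

variable {N : ℕ} {k : ℤ}

/-- `g Tᴺ g⁻¹ ∈ Γ₁(N)` for every `g ∈ SL(2, ℤ)` (`Tᴺ ∈ Γ(N)`, which is normal, and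
`Γ(N) ≤ Γ₁(N)`). [folklore] -/
theorem conj_T_zpow_mem_Gamma1 (g : SL(2, ℤ)) :
    g * ModularGroup.T ^ (N : ℤ) * g⁻¹ ∈ Gamma1 N := by
  have hT : ModularGroup.T ^ (N : ℤ) ∈ CongruenceSubgroup.Gamma N := by
    simpa using ModularGroup_T_pow_mem_Gamma N N dvd_rfl
  have := (Gamma_normal N).conj_mem _ hT g
  rw [Gamma_mem] at this
  rw [Gamma1_mem]
  exact ⟨this.1, this.2.2.2, this.2.2.1⟩

/-- An `SL(2, ℤ)`-translate `f ∣[k] g` of a cusp form on `Γ₁(N)` is `Tᴺ`-invariant. [folklore] -/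
theorem slash_T_zpow_gamma1 (f : CuspForm (Gamma1 N) k) (g : SL(2, ℤ)) :
    (⇑f ∣[k] g) ∣[k] (ModularGroup.T ^ (N : ℤ)) = ⇑f ∣[k] g := by
  have h1 : ⇑f ∣[k] (g * ModularGroup.T ^ (N : ℤ) * g⁻¹) = ⇑f := by
    rw [ModularForm.SL_slash]
    exact SlashInvariantForm.slash_action_eqn f _
      (Subgroup.mem_map_of_mem (Matrix.SpecialLinearGroup.mapGL ℝ) (conj_T_zpow_mem_Gamma1 g))
  calc (⇑f ∣[k] g) ∣[k] (ModularGroup.T ^ (N : ℤ))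
      = ⇑f ∣[k] ((g * ModularGroup.T ^ (N : ℤ) * g⁻¹) * g) := by
        rw [← SlashAction.slash_mul]; congr 1; group
    _ = ⇑f ∣[k] g := by rw [SlashAction.slash_mul, h1]

/-- Hence `(f ∣[k] g) ∘ ofComplex` is `N`-periodic. [folklore] -/
theorem periodic_slash_gamma1 (f : CuspForm (Gamma1 N) k) (g : SL(2, ℤ)) :
    Periodic ((⇑f ∣[k] g) ∘ ofComplex) (N : ℝ) := by
  intro w
  by_cases hw : 0 < w.im
  · have hw' : 0 < (w + (N : ℝ)).im := by simpa using hw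
    have hT : ModularGroup.T ^ (N : ℤ) • ofComplex w = ofComplex (w + (N : ℝ)) := by
      ext1
      rw [ModularGroup.coe_T_zpow_smul_eq, ofComplex_apply_of_im_pos hw,
        ofComplex_apply_of_im_pos hw']
      simp
    have := congr_fun (slash_T_zpow_gamma1 f g) (ofComplex w)
    rw [ModularForm.SL_slash_apply, hT] at this
    simp only [comp_apply]
    rw [← this]
    have hd : denom (ModularGroup.T ^ (N : ℤ) : SL(2, ℤ)) (ofComplex w) = 1 := by
      rw [ModularGroup.denom_apply, ModularGroup.coe_T_zpow]
      simp
    rw [hd, one_zpow, mul_one]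
  · have hw' : (w + (N : ℝ)).im ≤ 0 := by simpa using hw
    simp only [comp_apply, ofComplex_apply_eq_of_im_nonpos hw' (not_lt.mp hw)]

/-- **`SL(2, ℤ)`-translates of cusp forms on `Γ₁(N)` are cuspidal `q`-series of period `N`.** [folklore] -/
theorem isCuspFunction_slash_gamma1 [NeZero N] (f : CuspForm (Gamma1 N) k) (g : SL(2, ℤ)) :
    IsCuspFunction N (⇑f ∣[k] g) where
  pos := by exact_mod_cast Nat.pos_of_ne_zero (NeZero.ne N)
  periodic := periodic_slash_gamma1 f g
  mdifferentiable := by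
    rw [ModularForm.SL_slash]
    exact (ModularFormClass.holo f).slash k _
  isZeroAtImInfty := CuspFormClass.zero_at_infty_slash f g

/-- **Cusp forms on `Γ₁(N)` are cuspidal `q`-series of period `1`.** [folklore] -/
theorem isCuspFunction_one_gamma1 [NeZero N] (f : CuspForm (Gamma1 N) k) :
    IsCuspFunction 1 ⇑f where
  pos := one_pos
  periodic := SlashInvariantFormClass.periodic_comp_ofComplex f
    (HeckeTGamma1.one_mem_strictPeriods_Gamma1 N)
  mdifferentiable := ModularFormClass.holo f
  isZeroAtImInfty := CuspFormClass.zero_at_infty f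

end CuspFunction

/-! ### Diamond operators as slashes, and `T_p` as a twisted sum over upper-triangular matrices -/

section DiamondHecke

variable (N : ℕ) [NeZero N] (k : ℤ)

/-- `⟨σ⟩ f = f ∣[k] σ` for every `σ ∈ Γ₀(N)` (Diamond–Shurman §5.2, p. 168: "for any
`α ∈ Γ₀(N)` with lower-right entry `δ ≡ d`"; the chosen lift in `diamondOp` is immaterial,
`slash_mapGL_eq_of_Gamma0Map_eq`). [cite: DiamondShurman2005, §5.2 p. 168] -/
theorem coe_diamondOp_eq_slash (σ : Gamma0 N) (f : CuspForm (Gamma1 N) k) :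
    (⇑(diamondOp N k (Gamma0Map N σ) f) : ℍ → ℂ) = ⇑f ∣[k] ((σ : SL(2, ℤ)) : GL (Fin 2) ℝ) := by
  have h : ∃ γ : Gamma0 N, Gamma0Map N γ = Gamma0Map N σ := ⟨σ, rfl⟩
  unfold diamondOp
  rw [dif_pos h, coe_cuspHeckeOperatorₗ_gamma1]
  exact slash_mapGL_eq_of_Gamma0Map_eq N k h.choose_spec f

/-- `⟨1⟩ = 1` as an endomorphism of `S_k(Γ₁(N))` (cf. `diamondOp_one_apply` of
`LanglandsTunnellLSeriesProofs`, not imported here). [folklore] -/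
theorem diamondOp_one_eq_id : diamondOp N k 1 = LinearMap.id := by
  refine LinearMap.ext fun f ↦ DFunLike.ext' ?_
  have := coe_diamondOp_eq_slash N k 1 f
  rw [map_one] at this
  rw [LinearMap.id_apply, this]
  simp

/-- The diamond twists in the coset decomposition of `T_p` on `S_k(Γ₁(N))` through the
upper-triangular matrices `βᵢ` of level `Γ₀(N)`: `ε_j = 1` for `β_j = (1 j; 0 p)` and `ε_∞ = p`
for `β_∞ = diag(p, 1)` (Diamond–Shurman p. 172: `f[(m n; N p) diag(p,1)]_k = (⟨p⟩ f)[diag(p,1)]_k`). [cite: DiamondShurman2005, proof of Prop. 5.2.2, p. 172] -/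
def heckeEps (p : ℕ) : Option (ZMod p) → ZMod N
  | some _ => 1
  | none => p

/-- **`T_p` on `S_k(Γ₁(N))` as a twisted sum over the level-`Γ₀(N)` representatives**:
`T_p f = ∑_{i ∈ I_p(N)} (⟨εᵢ⟩ f) ∣[k] βᵢ = ∑_{j mod p} f ∣[k] (1 j; 0 p) + 𝟙_{p∤N} (⟨p⟩ f) ∣[k] diag(p,1)`
(Diamond–Shurman Prop. 5.2.1 with the identity of p. 172). [cite: DiamondShurman2005, Prop. 5.2.1 and p. 172] -/
theorem coe_heckeT_gamma1 (p : ℕ) [NeZero p] (hp : p.Prime) (f : CuspForm (Gamma1 N) k) :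
    (⇑(heckeT (Gamma1 N) k p f) : ℍ → ℂ) =
      ∑ i : HeckeIdx N p, ⇑(diamondOp N k (heckeEps N p i.1) f) ∣[k] intGL (heckeRep p i.1) := by
  rw [sum_heckeIdx N p fun i ↦ ⇑(diamondOp N k (heckeEps N p i) f) ∣[k] intGL (heckeRep p i)]
  simp only [heckeEps, intGL_heckeRep_some, intGL_heckeRep_none, diamondOp_one_eq_id,
    LinearMap.id_apply]
  rw [sum_zmod_val_eq_sum_fin p fun j ↦ ⇑f ∣[k] tpB p (j : ℤ)]
  by_cases hpN : p ∣ N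
  · rw [if_pos hpN, add_zero, coe_heckeT_gamma1_eq_sum_of_dvd N k p hp hpN f]
    rfl
  · rw [if_neg hpN, coe_heckeT_gamma1_eq_sum_of_not_dvd N k p hp hpN f, add_comm]
    rfl

end DiamondHecke


/-! ### The period cocycle of a form of level `Γ₁(N)` over `Γ₀(N)` -/

section Cocycle

variable {N : ℕ} [NeZero N] {n : ℕ}

/-- `coe_diamondOp_eq_slash` for the `SL(2, ℤ)`-slash action. [folklore] -/
theorem coe_diamondOp_eq_SL_slash (σ : Gamma0 N) (f : CuspForm (Gamma1 N) (n + 2)) :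
    (⇑(diamondOp N (n + 2) (Gamma0Map N σ) f) : ℍ → ℂ) = ⇑f ∣[(n + 2 : ℤ)] (σ : SL(2, ℤ)) := by
  rw [ModularForm.SL_slash]
  exact coe_diamondOp_eq_slash N (n + 2) σ f

variable (n)

/-- **The period cocycle** of `f ∈ S_{n+2}(Γ₁(N))` at `γ ∈ SL(2, ℤ)`, as a function of
`p = (u, v)`: `∫_τ^{i∞} (f|γ)(z)(zv - u)ⁿ dz - ∫_{γτ}^{i∞} f(z)(zv' - u')ⁿ dz`, `(u', v') = γ(u, v)`
(independent of `τ`, `periodFn1_eq`); for `γ ∈ Γ₁(N)` this is the parabolic cocycle of Shimura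
(8.2.20), and we use it for all `γ ∈ Γ₀(N)`. [cite: Shimura1971, §8.2 (8.2.20)] -/
def periodFn1 (f : CuspForm (Gamma1 N) (n + 2)) (γ : SL(2, ℤ)) (p : Fin 2 → ℂ) : ℂ :=
  eichlerKernel n (⇑f ∣[(n + 2 : ℤ)] γ) UpperHalfPlane.I p -
    eichlerKernel n ⇑f (γ • UpperHalfPlane.I) ((icmat γ).mulVec p)

variable {n}

/-- The period cocycle may be computed at any base point. [folklore] -/
theorem periodFn1_eq (f : CuspForm (Gamma1 N) (n + 2)) (γ : SL(2, ℤ)) (p : Fin 2 → ℂ) (τ : ℍ) :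
    periodFn1 n f γ p = eichlerKernel n (⇑f ∣[(n + 2 : ℤ)] γ) τ p -
      eichlerKernel n ⇑f (γ • τ) ((icmat γ).mulVec p) := by
  have hφ := isCuspFunction_one_gamma1 f
  have hψ : IsCuspFunction N (⇑f ∣[(n + 2 : ℤ)] (γ : GL (Fin 2) ℝ)) :=
    isCuspFunction_slash_gamma1 f γ
  have := hφ.eichlerKernel_slash_sub_eq (det_coe_pos γ) hψ p UpperHalfPlane.I τ
  rw [cmat_coe] at this
  exact this

omit [NeZero N] in
/-- For `γ ∈ Γ₁(N)`, `f ∣ γ = f`. [folklore] -/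
theorem slash_eq_self_of_mem_gamma1 (f : CuspForm (Gamma1 N) (n + 2)) {γ : SL(2, ℤ)}
    (hγ : γ ∈ Gamma1 N) : ⇑f ∣[(n + 2 : ℤ)] γ = ⇑f := by
  rw [ModularForm.SL_slash]
  exact SlashInvariantForm.slash_action_eqn f _
    (Subgroup.mem_map_of_mem (Matrix.SpecialLinearGroup.mapGL ℝ) hγ)

/-- For `γ ∈ Γ₁(N)`: `periodFn1 = ∫_τ^{i∞} f(z)(zv - u)ⁿ dz - ∫_{γτ}^{i∞} f(z)(zv' - u')ⁿ dz`. [folklore] -/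
theorem periodFn1_eq_of_mem (f : CuspForm (Gamma1 N) (n + 2)) {γ : SL(2, ℤ)} (hγ : γ ∈ Gamma1 N)
    (p : Fin 2 → ℂ) (τ : ℍ) : periodFn1 n f γ p =
      eichlerKernel n ⇑f τ p - eichlerKernel n ⇑f (γ • τ) ((icmat γ).mulVec p) := by
  rw [periodFn1_eq f γ p τ, slash_eq_self_of_mem_gamma1 f hγ]

/-- `c(1) = 0`. [folklore] -/
@[simp] theorem periodFn1_one (f : CuspForm (Gamma1 N) (n + 2)) (p : Fin 2 → ℂ) :
    periodFn1 n f 1 p = 0 := by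
  rw [periodFn1_eq f 1 p UpperHalfPlane.I]
  simp

/-- **The cocycle relation over `Γ₀(N)`**: `c_f(σδ)(p) = c_{⟨σ⟩f}(δ)(p) + c_f(σ)(δp)` for
`σ ∈ Γ₀(N)`, `δ ∈ SL(2, ℤ)` (at level `Γ₁(N)` the form is twisted by the diamond operator of
`σ`). [cite: Shimura1971, §8.2 p. 233 (t(αβ) = t(α) + χ(α)t(β))] -/
theorem periodFn1_mul (f : CuspForm (Gamma1 N) (n + 2)) (σ : Gamma0 N) (δ : SL(2, ℤ))
    (p : Fin 2 → ℂ) :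
    periodFn1 n f ((σ : SL(2, ℤ)) * δ) p =
      periodFn1 n (diamondOp N (n + 2) (Gamma0Map N σ) f) δ p +
        periodFn1 n f σ ((icmat δ).mulVec p) := by
  rw [periodFn1_eq f ((σ : SL(2, ℤ)) * δ) p UpperHalfPlane.I, periodFn1_eq _ δ p UpperHalfPlane.I,
    periodFn1_eq f (σ : SL(2, ℤ)) _ (δ • UpperHalfPlane.I), coe_diamondOp_eq_SL_slash,
    ← SlashAction.slash_mul, mul_smul, icmat_mul, ← Matrix.mulVec_mulVec]
  ring

/-- The periods of a diamond twist: `c_{⟨σ⟩f}(δ)(p) = c_f(σδ)(p) - c_f(σ)(δp)`. [folklore] -/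
theorem periodFn1_diamondOp (f : CuspForm (Gamma1 N) (n + 2)) (σ : Gamma0 N) (δ : SL(2, ℤ))
    (p : Fin 2 → ℂ) :
    periodFn1 n (diamondOp N (n + 2) (Gamma0Map N σ) f) δ p =
      periodFn1 n f ((σ : SL(2, ℤ)) * δ) p - periodFn1 n f σ ((icmat δ).mulVec p) := by
  rw [periodFn1_mul]
  ring

/-- `c_f(σ⁻¹)(p) = -c_{⟨σ⁻¹⟩f}(σ)(σ⁻¹p)` for `σ ∈ Γ₀(N)`. [folklore] -/
theorem periodFn1_inv (f : CuspForm (Gamma1 N) (n + 2)) (σ : Gamma0 N) (p : Fin 2 → ℂ) :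
    periodFn1 n f ((σ⁻¹ : Gamma0 N) : SL(2, ℤ)) p =
      -periodFn1 n (diamondOp N (n + 2) (Gamma0Map N σ⁻¹) f) σ
        ((icmat ((σ⁻¹ : Gamma0 N) : SL(2, ℤ))).mulVec p) := by
  have h := periodFn1_mul f σ⁻¹ (σ : SL(2, ℤ)) ((icmat ((σ⁻¹ : Gamma0 N) : SL(2, ℤ))).mulVec p)
  have h1 : ((σ⁻¹ : Gamma0 N) : SL(2, ℤ)) * (σ : SL(2, ℤ)) = 1 := by simp
  have h2 : (icmat (σ : SL(2, ℤ))).mulVec ((icmat ((σ⁻¹ : Gamma0 N) : SL(2, ℤ))).mulVec p) = p := by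
    rw [Matrix.mulVec_mulVec, ← icmat_mul]
    simp
  rw [h1, periodFn1_one, h2] at h
  linear_combination -h

/-- Additivity in `f`. [folklore] -/
theorem periodFn1_add (f g : CuspForm (Gamma1 N) (n + 2)) (γ : SL(2, ℤ)) (p : Fin 2 → ℂ) :
    periodFn1 n (f + g) γ p = periodFn1 n f γ p + periodFn1 n g γ p := by
  simp only [periodFn1]
  have h1 : (⇑(f + g) : ℍ → ℂ) ∣[(n + 2 : ℤ)] γ = ⇑f ∣[(n + 2 : ℤ)] γ + ⇑g ∣[(n + 2 : ℤ)] γ := by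
    rw [CuspForm.coe_add, SlashAction.add_slash]
  rw [h1, (isCuspFunction_slash_gamma1 f γ).eichlerKernel_add (isCuspFunction_slash_gamma1 g γ),
    CuspForm.coe_add, (isCuspFunction_one_gamma1 f).eichlerKernel_add (isCuspFunction_one_gamma1 g)]
  ring

omit [NeZero N] in
/-- Homogeneity in `f`. [folklore] -/
theorem periodFn1_smul (c : ℂ) (f : CuspForm (Gamma1 N) (n + 2)) (γ : SL(2, ℤ))
    (p : Fin 2 → ℂ) : periodFn1 n (c • f) γ p = c * periodFn1 n f γ p := by
  simp only [periodFn1]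
  have h1 : (⇑(c • f) : ℍ → ℂ) ∣[(n + 2 : ℤ)] γ = c • (⇑f ∣[(n + 2 : ℤ)] γ) := by
    rw [CuspForm.IsGLPos.coe_smul, ModularForm.SL_smul_slash]
  rw [h1, eichlerKernel_const_smul, CuspForm.IsGLPos.coe_smul, eichlerKernel_const_smul]
  ring

variable (n)

/-- **Period functionals** `λ_{σ,q} : f ↦ c_f(σ)(u, v)` for `σ ∈ Γ₀(N)` and integers `u, v`. [cite: Shimura1971, §8.4 (8.4.1)] -/
def periodFunctionalK1 (σ : Gamma0 N) (q : Fin 2 → ℤ) :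
    Module.Dual ℂ (CuspForm (Gamma1 N) (n + 2)) where
  toFun f := periodFn1 n f σ (fun i ↦ (q i : ℂ))
  map_add' f g := periodFn1_add f g σ _
  map_smul' c f := periodFn1_smul c f σ _

/-- Unfolding `periodFunctionalK1`. [folklore] -/
@[simp] theorem periodFunctionalK1_apply (σ : Gamma0 N) (q : Fin 2 → ℤ)
    (f : CuspForm (Gamma1 N) (n + 2)) :
    periodFunctionalK1 n σ q f = periodFn1 n f σ (fun i ↦ (q i : ℂ)) := rfl

/-- **The Eichler–Shimura period lattice** in the dual of `S_{n+2}(Γ₁(N))`: the subgroup generated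
by the period functionals `λ_{σ,q}`, `σ ∈ Γ₀(N)`, `q ∈ ℤ²`. [cite: Shimura1971, §8.4 Prop. 8.6] -/
def periodLatticeK1 : AddSubgroup (Module.Dual ℂ (CuspForm (Gamma1 N) (n + 2))) :=
  AddSubgroup.closure (Set.range fun γq : Gamma0 N × (Fin 2 → ℤ) ↦ periodFunctionalK1 n γq.1 γq.2)

variable {n}

/-- The generators lie in the period lattice. [folklore] -/
theorem periodFunctionalK1_mem (σ : Gamma0 N) (q : Fin 2 → ℤ) :
    periodFunctionalK1 n σ q ∈ periodLatticeK1 (N := N) n :=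
  AddSubgroup.subset_closure ⟨(σ, q), rfl⟩

/-- `λ_{1,q} = 0`. [folklore] -/
@[simp] theorem periodFunctionalK1_one (q : Fin 2 → ℤ) :
    periodFunctionalK1 n (1 : Gamma0 N) q = 0 := by
  ext f
  simp

/-- **Diamond operators on the period functionals**:
`⟨σ⟩^∨ λ_{δ,q} = λ_{σδ,q} - λ_{σ,δq}` for `σ, δ ∈ Γ₀(N)`. [folklore] -/
theorem dualMap_diamondOp_periodFunctionalK1 (σ δ : Gamma0 N) (q : Fin 2 → ℤ) :
    (diamondOp N (n + 2) (Gamma0Map N σ)).dualMap (periodFunctionalK1 n δ q) =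
      periodFunctionalK1 n (σ * δ) q -
        periodFunctionalK1 n σ (((δ : SL(2, ℤ)) : Matrix (Fin 2) (Fin 2) ℤ).mulVec q) := by
  ext f
  simp only [LinearMap.dualMap_apply, periodFunctionalK1_apply, LinearMap.sub_apply]
  rw [periodFn1_diamondOp, icmat_mulVec_intCast, Subgroup.coe_mul]

/-- The cocycle relation for the functionals: `⟨u⟩^∨ λ_{xy,q} = ⟨x u⟩^∨ λ_{y,q} + ⟨u⟩^∨ λ_{x,yq}`. [folklore] -/
theorem dualMap_diamondOp_periodFunctionalK1_mul {u : ZMod N} (hu : IsUnit u) (x y : Gamma0 N)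
    (q : Fin 2 → ℤ) :
    (diamondOp N (n + 2) u).dualMap (periodFunctionalK1 n (x * y) q) =
      (diamondOp N (n + 2) (Gamma0Map N x * u)).dualMap (periodFunctionalK1 n y q) +
        (diamondOp N (n + 2) u).dualMap
          (periodFunctionalK1 n x (((y : SL(2, ℤ)) : Matrix (Fin 2) (Fin 2) ℤ).mulVec q)) := by
  ext f
  simp only [LinearMap.dualMap_apply, periodFunctionalK1_apply, LinearMap.add_apply]
  rw [Subgroup.coe_mul, periodFn1_mul, diamondOp_mul_holds N (n + 2) (isUnit_Gamma0Map N x) hu,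
    Module.End.mul_apply, icmat_mulVec_intCast]

/-- The cocycle relation at an inverse: `⟨u⟩^∨ λ_{x⁻¹,q} = -⟨x⁻¹ u⟩^∨ λ_{x,x⁻¹q}`. [folklore] -/
theorem dualMap_diamondOp_periodFunctionalK1_inv {u : ZMod N} (hu : IsUnit u) (x : Gamma0 N)
    (q : Fin 2 → ℤ) :
    (diamondOp N (n + 2) u).dualMap (periodFunctionalK1 n x⁻¹ q) =
      -(diamondOp N (n + 2) (Gamma0Map N x⁻¹ * u)).dualMap
        (periodFunctionalK1 n x
          ((((x⁻¹ : Gamma0 N) : SL(2, ℤ)) : Matrix (Fin 2) (Fin 2) ℤ).mulVec q)) := by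
  ext f
  simp only [LinearMap.dualMap_apply, periodFunctionalK1_apply, LinearMap.neg_apply]
  rw [periodFn1_inv, diamondOp_mul_holds N (n + 2) (isUnit_Gamma0Map N x⁻¹) hu,
    Module.End.mul_apply, icmat_mulVec_intCast]

/-- **The diamond operators `⟨d⟩^∨` preserve the period lattice** (for a non-unit `d` the
operator `⟨d⟩` is the identity by definition). [cite: DiamondShurman2005, §6.5 p. 237] -/
theorem dualMap_diamondOp_mem_periodLatticeK1 (d : ZMod N)
    {φ : Module.Dual ℂ (CuspForm (Gamma1 N) (n + 2))} (hφ : φ ∈ periodLatticeK1 (N := N) n) :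
    (diamondOp N (n + 2) d).dualMap φ ∈ periodLatticeK1 (N := N) n := by
  by_cases hd : ∃ γ : Gamma0 N, Gamma0Map N γ = d
  · obtain ⟨σ, rfl⟩ := hd
    induction hφ using AddSubgroup.closure_induction with
    | mem x hx =>
      obtain ⟨⟨δ, q⟩, rfl⟩ := hx
      rw [dualMap_diamondOp_periodFunctionalK1]
      exact sub_mem (periodFunctionalK1_mem _ _) (periodFunctionalK1_mem _ _)
    | zero => simp [zero_mem]
    | add x y _ _ hx hy => rw [map_add]; exact add_mem hx hy
    | neg x _ hx => rw [map_neg]; exact neg_mem hx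
  · have : diamondOp N (n + 2) d = LinearMap.id := by
      unfold diamondOp
      rw [dif_neg hd]
    rw [this, LinearMap.dualMap_id]
    exact hφ

end Cocycle

/-! ### The period lattice is finitely generated -/

section FG

variable {N : ℕ} [NeZero N] (n : ℕ)

/-- Moment functionals `f ↦ C(n,j) ∫_{hI}^{i∞} (f|g)(z) zʲ dz`, `g, h ∈ SL(2, ℤ)`. [folklore] -/
def momentFunctional1 (g h : SL(2, ℤ)) (j : ℕ) : Module.Dual ℂ (CuspForm (Gamma1 N) (n + 2)) where
  toFun f := (n.choose j : ℂ) * powPrimitive j (⇑f ∣[(n + 2 : ℤ)] g) (h • UpperHalfPlane.I)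
  map_add' f f' := by
    have h1 : (⇑(f + f') : ℍ → ℂ) ∣[(n + 2 : ℤ)] g =
        ⇑f ∣[(n + 2 : ℤ)] g + ⇑f' ∣[(n + 2 : ℤ)] g := by
      rw [CuspForm.coe_add, SlashAction.add_slash]
    rw [h1, (isCuspFunction_slash_gamma1 f g).powPrimitive_add j
      (isCuspFunction_slash_gamma1 f' g)]
    ring
  map_smul' c f := by
    have h1 : (⇑(c • f) : ℍ → ℂ) ∣[(n + 2 : ℤ)] g = c • (⇑f ∣[(n + 2 : ℤ)] g) := by
      rw [CuspForm.IsGLPos.coe_smul, ModularForm.SL_smul_slash]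
    rw [h1, powPrimitive_const_smul]
    simp only [RingHom.id_apply, smul_eq_mul]
    ring

variable {n}

/-- The twisted period functional `⟨ρ⟩^∨ λ_{s,q}` is an integral combination of the `2(n+1)`
moment functionals of `(ρ s, 1)` and `(ρ, s)`. [folklore] -/
theorem dualMap_diamondOp_periodFunctionalK1_eq_sum (ρ s : Gamma0 N) (q : Fin 2 → ℤ) :
    (diamondOp N (n + 2) (Gamma0Map N ρ)).dualMap (periodFunctionalK1 n s q) =
      ∑ j ∈ Finset.range (n + 1),
        (q 1 ^ j * (-(q 0)) ^ (n - j)) • momentFunctional1 n ((ρ : SL(2, ℤ)) * s) 1 j -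
      ∑ j ∈ Finset.range (n + 1),
        ((((s : SL(2, ℤ)) : Matrix (Fin 2) (Fin 2) ℤ).mulVec q 1) ^ j *
          (-(((s : SL(2, ℤ)) : Matrix (Fin 2) (Fin 2) ℤ).mulVec q 0)) ^ (n - j)) •
          momentFunctional1 n ρ s j := by
  ext f
  simp only [LinearMap.dualMap_apply, periodFunctionalK1_apply, periodFn1, eichlerKernel,
    LinearMap.sub_apply, LinearMap.coe_sum, Finset.sum_apply, LinearMap.smul_apply,
    icmat_mulVec_intCast, coe_diamondOp_eq_SL_slash, ← SlashAction.slash_mul]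
  congr 1
  · refine Finset.sum_congr rfl fun j _ ↦ ?_
    simp only [momentFunctional1, LinearMap.coe_mk, AddHom.coe_mk, zsmul_eq_mul, one_smul]
    push_cast
    ring
  · refine Finset.sum_congr rfl fun j _ ↦ ?_
    simp only [momentFunctional1, LinearMap.coe_mk, AddHom.coe_mk, zsmul_eq_mul]
    push_cast
    ring

variable (N n) in
/-- **The Eichler–Shimura period lattice of `S_{n+2}(Γ₁(N))` is finitely generated**: `Γ₀(N)` is
finitely generated and `(ℤ/Nℤ)ˣ` is finite; the twisted cocycle relation reduces every
`⟨u⟩^∨ λ_{σ,q}` to the generators, and each `⟨u⟩^∨ λ_{s,q}` is an integral combination of finitely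
many moment functionals. [cite: Shimura1971, Prop. 8.6 (proof), p. 239] -/
theorem periodLatticeK1_fg : (periodLatticeK1 (N := N) n).FG := by
  classical
  obtain ⟨S, hS⟩ := Group.fg_def.mp (inferInstance : Group.FG (Gamma0 N))
  have hlift : ∀ u : (ZMod N)ˣ, ∃ ρ : Gamma0 N, Gamma0Map N ρ = u := fun u ↦
    exists_gamma0Map_eq_holds N u.isUnit
  choose ρ hρ using hlift
  -- the finite set of moment functionals
  let T : Finset (Module.Dual ℂ (CuspForm (Gamma1 N) (n + 2))) :=
    Finset.univ.biUnion fun u : (ZMod N)ˣ ↦ S.biUnion fun s ↦ (Finset.range (n + 1)).biUnion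
      fun j ↦ {momentFunctional1 n ((ρ u : SL(2, ℤ)) * s) 1 j, momentFunctional1 n (ρ u) s j}
  let L : Submodule ℤ (Module.Dual ℂ (CuspForm (Gamma1 N) (n + 2))) :=
    Submodule.span ℤ (T : Set _)
  haveI : Module.Finite ℤ L := Module.Finite.span_of_finite ℤ T.finite_toSet
  have hT : ∀ (u : (ZMod N)ˣ), ∀ s ∈ S, ∀ j ∈ Finset.range (n + 1),
      momentFunctional1 n ((ρ u : SL(2, ℤ)) * s) 1 j ∈ L.toAddSubgroup ∧
        momentFunctional1 n (ρ u) s j ∈ L.toAddSubgroup := by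
    intro u s hs j hj
    have hsub : ∀ φ ∈ T, φ ∈ L.toAddSubgroup := fun φ hφ ↦ Submodule.subset_span hφ
    constructor <;> apply hsub <;> simp only [T, Finset.mem_biUnion, Finset.mem_insert,
      Finset.mem_singleton, Finset.mem_univ, true_and] <;> exact ⟨u, s, hs, j, hj, by simp⟩
  -- every twisted `⟨u⟩^∨ λ_{σ,q}` lies in `L`
  have hmem : ∀ (σ : Gamma0 N) (u : (ZMod N)ˣ) (q : Fin 2 → ℤ),
      (diamondOp N (n + 2) (u : ZMod N)).dualMap (periodFunctionalK1 n σ q) ∈ L.toAddSubgroup := by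
    intro σ
    have hσ : σ ∈ Subgroup.closure (S : Set (Gamma0 N)) := by rw [hS]; trivial
    induction hσ using Subgroup.closure_induction with
    | mem s hs =>
      intro u q
      rw [← hρ u, dualMap_diamondOp_periodFunctionalK1_eq_sum]
      exact sub_mem (AddSubgroup.sum_mem _ fun j hj ↦ AddSubgroup.zsmul_mem _ (hT u s hs j hj).1 _)
        (AddSubgroup.sum_mem _ fun j hj ↦ AddSubgroup.zsmul_mem _ (hT u s hs j hj).2 _)
    | one =>
      intro u q
      rw [periodFunctionalK1_one, map_zero]
      exact zero_mem _
    | mul x y _ _ hx hy =>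
      intro u q
      obtain ⟨u', hu'⟩ := (isUnit_Gamma0Map N x).mul u.isUnit
      rw [dualMap_diamondOp_periodFunctionalK1_mul u.isUnit, ← hu']
      exact add_mem (hy u' q) (hx u _)
    | inv x _ hx =>
      intro u q
      obtain ⟨u', hu'⟩ := (isUnit_Gamma0Map N x⁻¹).mul u.isUnit
      rw [dualMap_diamondOp_periodFunctionalK1_inv u.isUnit, ← hu']
      exact neg_mem (hx u' _)
  have hle : (periodLatticeK1 (N := N) n).toIntSubmodule ≤ L := by
    intro φ hφ
    have hφ' : φ ∈ periodLatticeK1 (N := N) n := hφ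
    refine (AddSubgroup.closure_le L.toAddSubgroup).mpr ?_ hφ'
    rintro _ ⟨⟨σ, q⟩, rfl⟩
    have := hmem σ 1 q
    rwa [Units.val_one, diamondOp_one_eq_id, LinearMap.dualMap_id] at this
  have hfin : Module.Finite ℤ (periodLatticeK1 (N := N) n).toIntSubmodule :=
    Module.Finite.of_injective (Submodule.inclusion hle) (Submodule.inclusion_injective hle)
  have := (Module.Finite.iff_fg).mp hfin
  rwa [Submodule.fg_iff_addSubgroup_fg, AddSubgroup.toIntSubmodule_toAddSubgroup] at this

end FG


/-! ### Eichler–Shimura injectivity: a cusp form with vanishing periods is zero -/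

section Separation

variable {N : ℕ} [NeZero N] {n : ℕ}

variable (n) in
/-- The weight `-n` **Eichler integral** `F_f(τ) = ∫_τ^{i∞} f(z)(z - τ)ⁿ dz` of
`f ∈ S_{n+2}(Γ₁(N))`. [folklore] -/
def eichlerIntegralK1 (f : CuspForm (Gamma1 N) (n + 2)) (τ : ℍ) : ℂ :=
  eichlerKernel n ⇑f τ ![(τ : ℂ), 1]

/-- **The weight `-n` action on the Eichler integral produces the period polynomial**:
`(F_f ∣[-n] γ)(τ) = ∫_τ^{i∞} (f|γ)(z)(z - τ)ⁿ dz - c_f(γ)(τ, 1)` for `γ ∈ SL(2, ℤ)`. [folklore] -/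
theorem eichlerIntegralK1_slash_apply (f : CuspForm (Gamma1 N) (n + 2)) (γ : SL(2, ℤ)) (τ : ℍ) :
    (eichlerIntegralK1 n f ∣[(-(n : ℤ))] γ) τ =
      eichlerKernel n (⇑f ∣[(n + 2 : ℤ)] γ) τ ![(τ : ℂ), 1] - periodFn1 n f γ ![(τ : ℂ), 1] := by
  rw [periodFn1_eq f γ _ τ, icmat_mulVec_vecCons γ τ.im_pos, eichlerKernel_smul_arg,
    ← coe_sl_smul, ModularForm.SL_slash_apply, neg_neg, zpow_natCast, eichlerIntegralK1,
    ModularGroup.denom_apply]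
  ring

/-- If `γ ∈ Γ₁(N)` has vanishing periods then `F_f ∣[-n] γ = F_f`. [folklore] -/
theorem eichlerIntegralK1_slash_eq_self (f : CuspForm (Gamma1 N) (n + 2)) {γ : SL(2, ℤ)}
    (hγ : γ ∈ Gamma1 N) (hγ0 : ∀ p, periodFn1 n f γ p = 0) :
    eichlerIntegralK1 n f ∣[(-(n : ℤ))] γ = eichlerIntegralK1 n f := by
  funext τ
  rw [eichlerIntegralK1_slash_apply, hγ0, sub_zero, slash_eq_self_of_mem_gamma1 f hγ]
  rfl

/-- The Eichler integral is holomorphic. [folklore] -/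
theorem mdifferentiable_eichlerIntegralK1 (f : CuspForm (Gamma1 N) (n + 2)) :
    MDifferentiable 𝓘(ℂ) 𝓘(ℂ) (eichlerIntegralK1 n f) := by
  rw [UpperHalfPlane.mdifferentiable_iff]
  have h : ∀ z : ℂ, 0 < z.im →
      DifferentiableAt ℂ (fun w ↦ eichlerKernel n ⇑f (ofComplex w) ![w, 1]) z := by
    intro z hz
    cases n with
    | zero => exact ((isCuspFunction_one_gamma1 f).hasDerivAt_eichlerKernel_diag_zero hz).differentiableAt
    | succ m =>
      exact ((isCuspFunction_one_gamma1 f).hasDerivAt_eichlerKernel_diag_succ m hz).differentiableAt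
  intro z hz
  refine (h z hz).differentiableWithinAt.congr (fun w (hw : 0 < w.im) ↦ ?_) ?_
  · simp [eichlerIntegralK1, ofComplex_apply_of_im_pos hw]
  · simp [eichlerIntegralK1, ofComplex_apply_of_im_pos hz]

omit [NeZero N] in
/-- The period function on the line `(t, 1)` is a polynomial in `t`. [folklore] -/
theorem exists_polynomial_periodFn1 (f : CuspForm (Gamma1 N) (n + 2)) (γ : SL(2, ℤ)) :
    ∃ R : Polynomial ℂ, ∀ t : ℂ, periodFn1 n f γ ![t, 1] = R.eval t := by
  refine ⟨∑ j ∈ Finset.range (n + 1), Polynomial.C ((n.choose j : ℂ) *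
      powPrimitive j (⇑f ∣[(n + 2 : ℤ)] γ) UpperHalfPlane.I) * (-Polynomial.X) ^ (n - j) -
    ∑ j ∈ Finset.range (n + 1), Polynomial.C ((n.choose j : ℂ) *
      powPrimitive j ⇑f (γ • UpperHalfPlane.I)) *
      (Polynomial.C ((γ 1 0 : ℤ) : ℂ) * Polynomial.X + Polynomial.C ((γ 1 1 : ℤ) : ℂ)) ^ j *
      (-(Polynomial.C ((γ 0 0 : ℤ) : ℂ) * Polynomial.X + Polynomial.C ((γ 0 1 : ℤ) : ℂ))) ^ (n - j),
    fun t ↦ ?_⟩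
  simp only [periodFn1, eichlerKernel, icmat_mulVec_vecCons', Polynomial.eval_sub,
    Polynomial.eval_finsetSum, Polynomial.eval_mul, Polynomial.eval_C, Polynomial.eval_pow,
    Polynomial.eval_neg, Polynomial.eval_X, Polynomial.eval_add, Matrix.cons_val_one,
    Matrix.cons_val_zero]
  congr 1
  refine Finset.sum_congr rfl fun j _ ↦ ?_
  ring

/-- **Boundedness of `F_f ∣[-n] g` at `∞`** for every `g ∈ SL(2, ℤ)`, when all periods over
`Γ₁(N)` vanish: `F_f ∣ g = G - P` with `G(τ) = ∫_τ^{i∞} (f|g)(z)(z-τ)ⁿ dz → 0` and `P` a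
polynomial; `F_f ∣ g` is `N`-periodic (`g Tᴺ g⁻¹ ∈ Γ₁(N)`), hence so is `P` up to `o(1)`, so
`P` is constant; and a periodic function bounded on a period strip is bounded. [cite: Shimura1971, §8.2 p. 233 (the limit F(s) at a cusp)] -/
theorem isBoundedAtImInfty_eichlerIntegralK1_slash (f : CuspForm (Gamma1 N) (n + 2))
    (hper : ∀ γ ∈ Gamma1 N, ∀ p : Fin 2 → ℂ, periodFn1 n f γ p = 0) (g : SL(2, ℤ)) :
    IsBoundedAtImInfty (eichlerIntegralK1 n f ∣[(-(n : ℤ))] g) := by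
  set ψ : ℍ → ℂ := ⇑f ∣[(n + 2 : ℤ)] g with hψdef
  have hψ : IsCuspFunction N ψ := isCuspFunction_slash_gamma1 f g
  set Fg : ℍ → ℂ := eichlerIntegralK1 n f ∣[(-(n : ℤ))] g with hFgdef
  obtain ⟨R, hR⟩ := exists_polynomial_periodFn1 f g
  -- (a) `Fg = G - P`
  have ha : ∀ τ : ℍ, Fg τ = eichlerKernel n ψ τ ![(τ : ℂ), 1] - R.eval (τ : ℂ) := fun τ ↦ by
    rw [hFgdef, eichlerIntegralK1_slash_apply, hR]
  -- (c) `Fg` is `N`-periodic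
  have hT : ∀ τ : ℍ, Fg (ModularGroup.T ^ (N : ℤ) • τ) = Fg τ := by
    intro τ
    have hmem := conj_T_zpow_mem_Gamma1 (N := N) g
    have h1 := eichlerIntegralK1_slash_eq_self f hmem (hper _ hmem)
    have h2 : Fg ∣[(-(n : ℤ))] (ModularGroup.T ^ (N : ℤ)) = Fg := by
      rw [hFgdef, ← SlashAction.slash_mul]
      conv_rhs => rw [← h1, ← SlashAction.slash_mul]
      congr 1
      simp [mul_assoc]
    rw [← slash_T_zpow_apply Fg (-(n : ℤ)) τ, h2]
  have hTc : ∀ {z : ℂ} (hz : 0 < z.im), ModularGroup.T ^ (N : ℤ) • ofComplex z =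
      ofComplex (z + N) := by
    intro z hz
    have hz' : 0 < (z + N).im := by simpa using hz
    ext1
    rw [ModularGroup.coe_T_zpow_smul_eq, ofComplex_apply_of_im_pos hz,
      ofComplex_apply_of_im_pos hz']
    simp
  -- (f) `R` is constant
  have hRper : ∀ t : ℂ, R.eval (t + N) = R.eval t := by
    set S : Polynomial ℂ := R.comp (Polynomial.X + Polynomial.C (N : ℂ)) - R
    have hS : ∀ t, S.eval t = R.eval (t + N) - R.eval t := fun t ↦ by
      simp [S, Polynomial.eval_comp]
    suffices S = 0 by
      intro t
      have := hS t
      rw [‹S = 0›, Polynomial.eval_zero] at this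
      exact sub_eq_zero.mp this.symm
    apply Polynomial.eq_zero_of_tendsto_vertical S 0
    have hlim := (hψ.tendsto_eichlerKernel_diag_atTop (n := n) N).sub
      (hψ.tendsto_eichlerKernel_diag_atTop (n := n) 0)
    rw [sub_zero] at hlim
    refine hlim.congr' ?_
    filter_upwards [eventually_gt_atTop (0 : ℝ)] with y hy
    have hz : 0 < (((0 : ℝ) : ℂ) + y * I).im := by simpa using hy
    have hzN : 0 < (((N : ℝ) : ℂ) + y * I).im := by simpa using hy
    have e1 := ha (ofComplex (((0 : ℝ) : ℂ) + y * I))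
    have e2 := ha (ofComplex (((N : ℝ) : ℂ) + y * I))
    have e3 := hT (ofComplex (((0 : ℝ) : ℂ) + y * I))
    have e4 : (((0 : ℝ) : ℂ) + y * I) + N = ((N : ℝ) : ℂ) + y * I := by push_cast; ring
    rw [hTc hz, e4] at e3
    rw [coe_ofComplex hz] at e1
    rw [coe_ofComplex hzN] at e2
    rw [hS, e4]
    linear_combination e1 - e2 + e3
  have hRconst : ∀ t : ℂ, R.eval t = R.eval 0 :=
    Polynomial.eval_eq_eval_zero_of_periodic R (by exact_mod_cast NeZero.ne N) hRper
  -- (e) the bound for `G` on the strip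
  obtain ⟨C, hC0, hC⟩ := hψ.exists_norm_eichlerKernel_le (n := n)
  have hNpos : (0 : ℝ) < N := by exact_mod_cast Nat.pos_of_ne_zero (NeZero.ne N)
  have ha' : 0 < 2 * Real.pi / N := by positivity
  have hlim := (tendsto_affine_pow_mul_exp_neg_atTop (2 * (1 + N)) 2 n ha').const_mul C
  rw [mul_zero] at hlim
  obtain ⟨A₀, hA₀⟩ := (hlim.eventually (ge_mem_nhds zero_lt_one)).exists_forall_of_atTop
  -- conclusion
  rw [isBoundedAtImInfty_iff]
  refine ⟨1 + ‖R.eval 0‖, max A₀ 1, fun τ hτ ↦ ?_⟩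
  have hy1 : 1 ≤ τ.im := le_trans (le_max_right _ _) hτ
  have hyA : A₀ ≤ τ.im := le_trans (le_max_left _ _) hτ
  -- reduce `re τ` modulo `N`
  have hperx : Function.Periodic (fun u : ℝ ↦ Fg (ofComplex (u + τ.im * I))) N := by
    intro u
    have hz : 0 < ((u : ℂ) + τ.im * I).im := by simpa using τ.im_pos
    have := hT (ofComplex ((u : ℂ) + τ.im * I))
    rw [hTc hz] at this
    simp only
    rw [← this]
    congr 2
    push_cast
    ring
  obtain ⟨x', hx', hxeq⟩ := hperx.exists_mem_Ico₀ hNpos τ.re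
  have hττ : τ = ofComplex ((τ.re : ℂ) + τ.im * I) := by
    ext1
    rw [ofComplex_apply_of_im_pos (by simpa using τ.im_pos)]
    apply Complex.ext <;> simp
  have hz' : 0 < ((x' : ℂ) + τ.im * I).im := by simpa using τ.im_pos
  set τ' : ℍ := ofComplex ((x' : ℂ) + τ.im * I) with hτ'
  have hτ'im : τ'.im = τ.im := by
    rw [hτ', ← UpperHalfPlane.coe_im, ofComplex_apply_of_im_pos hz']; simp
  have hτ're : τ'.re = x' := by
    rw [hτ', ← UpperHalfPlane.coe_re, ofComplex_apply_of_im_pos hz']; simp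
  have hval : Fg τ = Fg τ' := by
    conv_lhs => rw [hττ]
    exact hxeq
  rw [hval, ha τ', hRconst]
  refine (norm_sub_le _ _).trans (add_le_add ?_ le_rfl)
  -- `‖G τ'‖ ≤ C (2(1+N+y))ⁿ e^{-a y} ≤ 1`
  have hG := hC τ' ![(τ' : ℂ), 1] (hτ'im ▸ hy1)
  refine hG.trans (le_trans ?_ (hA₀ τ.im hyA))
  rw [hτ'im, hτ're, mul_assoc]
  refine mul_le_mul_of_nonneg_left (mul_le_mul_of_nonneg_right ?_ (Real.exp_pos _).le) hC0
  apply pow_le_pow_left₀ (by positivity)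
  have hx'abs : |x'| ≤ N := by rw [abs_of_nonneg hx'.1]; exact hx'.2.le
  have hnorm : ‖(τ' : ℂ)‖ ≤ N + τ.im := by
    refine (Complex.norm_le_abs_re_add_abs_im _).trans ?_
    rw [UpperHalfPlane.coe_re, UpperHalfPlane.coe_im, hτ're, hτ'im, abs_of_pos τ.im_pos]
    linarith
  simp only [Matrix.cons_val_one, Matrix.cons_val_zero, norm_one, mul_one]
  nlinarith [τ.im_pos]

/-- **The Eichler integral of a form of level `Γ₁(N)` with vanishing periods over `Γ₁(N)` is a
modular form of weight `-n` on `Γ₁(N)`.** [cite: Shimura1971, Thm. 8.4 (injectivity of φ)] -/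
def eichlerIntegralK1Form (f : CuspForm (Gamma1 N) (n + 2))
    (hper : ∀ γ ∈ Gamma1 N, ∀ p : Fin 2 → ℂ, periodFn1 n f γ p = 0) :
    ModularForm (Gamma1 N) (-(n : ℤ)) where
  toFun := eichlerIntegralK1 n f
  slash_action_eq' := by
    rintro _ ⟨γ, hγ, rfl⟩
    exact eichlerIntegralK1_slash_eq_self f hγ (hper γ hγ)
  holo' := mdifferentiable_eichlerIntegralK1 f
  bdd_at_cusps' := by
    intro c hc
    rw [Subgroup.IsArithmetic.isCusp_iff_isCusp_SL2Z] at hc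
    rw [OnePoint.isBoundedAt_iff_forall_SL2Z hc]
    intro g _
    exact isBoundedAtImInfty_eichlerIntegralK1_slash f hper g

/-- A modular form of weight `k ≤ 0` on `Γ₁(N)` is constant (Mathlib:
`ModularForm.isZero_of_neg_weight`, `ModularForm.eq_const_of_weight_zero`). [folklore] -/
theorem exists_eq_const_of_weight_nonpos_gamma1 {k : ℤ} (hk : k ≤ 0) (F : ModularForm (Gamma1 N) k) :
    ∃ c : ℂ, ∀ τ : ℍ, F τ = c := by
  rcases hk.lt_or_eq with hk | rfl
  · refine ⟨0, fun τ ↦ ?_⟩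
    have h0 := ModularForm.isZero_of_neg_weight hk F
    rw [h0]
    rfl
  · obtain ⟨c, hc⟩ := ModularForm.eq_const_of_weight_zero F
    exact ⟨c, fun τ ↦ congr_fun hc τ⟩

/-- **Eichler–Shimura injectivity at level `Γ₁(N)`.** A cusp form `f ∈ S_{n+2}(Γ₁(N))` all of
whose periods `c_f(γ)(u, v)`, `γ ∈ Γ₁(N)`, vanish is zero: its Eichler integral is a modular form of weight
`-n ≤ 0`, hence constant, and then `f = 0` by differentiating `n + 1` times. [cite: Shimura1971, Thm. 8.4 (injectivity of φ), p. 234] -/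
theorem eq_zero_of_forall_periodFn1_eq_zero (f : CuspForm (Gamma1 N) (n + 2))
    (hper : ∀ γ ∈ Gamma1 N, ∀ p : Fin 2 → ℂ, periodFn1 n f γ p = 0) : f = 0 := by
  -- the Eichler integral is constant
  have hconst : ∃ c : ℂ, ∀ z : ℂ, 0 < z.im → eichlerKernel n ⇑f (ofComplex z) ![z, 1] = c := by
    obtain ⟨c, hc⟩ := exists_eq_const_of_weight_nonpos_gamma1 (by omega) (eichlerIntegralK1Form f hper)
    refine ⟨c, fun z hz ↦ ?_⟩
    have := hc (ofComplex z)
    change eichlerKernel n ⇑f (ofComplex z) ![((ofComplex z : ℍ) : ℂ), 1] = c at this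
    rwa [coe_ofComplex hz] at this
  have hzero := (isCuspFunction_one_gamma1 f).eq_zero_of_eichlerKernel_diag_const n hconst
  exact DFunLike.ext f 0 fun τ ↦ by simpa using hzero τ

end Separation

/-! ### Integer points suffice -/

section IntegerPoints

variable {N : ℕ} [NeZero N] {n : ℕ}

omit [NeZero N] in
/-- Along an affine line the period function is a polynomial in `t`. [folklore] -/
theorem exists_polynomial_periodFn1_affine (f : CuspForm (Gamma1 N) (n + 2)) (γ : SL(2, ℤ))
    (a b : Fin 2 → ℂ) :
    ∃ R : Polynomial ℂ, ∀ t : ℂ, periodFn1 n f γ (t • a + b) = R.eval t := by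
  obtain ⟨R₁, h₁⟩ := exists_polynomial_eichlerKernel_affine (n := n) (⇑f ∣[(n + 2 : ℤ)] γ)
    UpperHalfPlane.I a b
  obtain ⟨R₂, h₂⟩ := exists_polynomial_eichlerKernel_affine (n := n) ⇑f (γ • UpperHalfPlane.I)
    ((icmat γ).mulVec a) ((icmat γ).mulVec b)
  refine ⟨R₁ - R₂, fun t ↦ ?_⟩
  rw [periodFn1, Matrix.mulVec_add, Matrix.mulVec_smul, h₁, h₂, Polynomial.eval_sub]

omit [NeZero N] in
/-- **If the periods of `γ` vanish at all integer points `(u, v) ∈ ℤ²` they vanish identically**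
(they are polynomial in `(u, v)`). [folklore] -/
theorem periodFn1_eq_zero_of_forall_int (f : CuspForm (Gamma1 N) (n + 2)) (γ : SL(2, ℤ))
    (h : ∀ q : Fin 2 → ℤ, periodFn1 n f γ (fun i ↦ (q i : ℂ)) = 0) (p : Fin 2 → ℂ) :
    periodFn1 n f γ p = 0 := by
  -- step 1: `v ∈ ℤ`, `u ∈ ℂ`
  have h1 : ∀ (v : ℤ) (u : ℂ), periodFn1 n f γ ![u, (v : ℂ)] = 0 := by
    intro v u
    obtain ⟨R, hR⟩ := exists_polynomial_periodFn1_affine f γ ![1, 0] ![0, (v : ℂ)]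
    have hline : ∀ t : ℂ, t • ![(1 : ℂ), 0] + ![0, (v : ℂ)] = ![t, (v : ℂ)] := fun t ↦ by
      funext i; fin_cases i <;> simp
    have hR0 : R = 0 := by
      refine Polynomial.eq_zero_of_forall_int_eval_eq_zero R fun m ↦ ?_
      rw [← hR, hline]
      have := h ![m, v]
      convert this using 2
      funext i; fin_cases i <;> simp
    have := hR u
    rwa [hline, hR0, Polynomial.eval_zero] at this
  -- step 2: `u ∈ ℂ`, `v ∈ ℂ`
  have h2 : ∀ u v : ℂ, periodFn1 n f γ ![u, v] = 0 := by
    intro u v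
    obtain ⟨R, hR⟩ := exists_polynomial_periodFn1_affine f γ ![0, 1] ![u, 0]
    have hline : ∀ t : ℂ, t • ![(0 : ℂ), 1] + ![u, 0] = ![u, t] := fun t ↦ by
      funext i; fin_cases i <;> simp
    have hR0 : R = 0 := by
      refine Polynomial.eq_zero_of_forall_int_eval_eq_zero R fun m ↦ ?_
      rw [← hR, hline]
      exact h1 m u
    have := hR v
    rwa [hline, hR0, Polynomial.eval_zero] at this
  have hp : p = ![p 0, p 1] := by funext i; fin_cases i <;> simp
  rw [hp]
  exact h2 _ _

/-- **Separation by the period lattice.** If every period functional `λ_{σ,q}`, `σ ∈ Γ₀(N)`,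
`q ∈ ℤ²`, vanishes on `f ∈ S_{n+2}(Γ₁(N))`, then `f = 0` (only `σ ∈ Γ₁(N)` is used). [cite: Shimura1971, Thm. 8.4] -/
theorem eq_zero_of_forall_periodFunctionalK1_eq_zero (f : CuspForm (Gamma1 N) (n + 2))
    (h : ∀ (σ : Gamma0 N) (q : Fin 2 → ℤ), periodFunctionalK1 n σ q f = 0) : f = 0 :=
  eq_zero_of_forall_periodFn1_eq_zero f fun γ hγ p ↦
    periodFn1_eq_zero_of_forall_int f γ (fun q ↦ h ⟨γ, Gamma1_in_Gamma0 N hγ⟩ q) p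

/-- Equivalently: if `φ(f) = 0` for all `φ` in the period lattice then `f = 0`. [folklore] -/
theorem eq_zero_of_forall_mem_periodLatticeK1 (f : CuspForm (Gamma1 N) (n + 2))
    (h : ∀ φ ∈ periodLatticeK1 (N := N) n, φ f = 0) : f = 0 :=
  eq_zero_of_forall_periodFunctionalK1_eq_zero f fun γ q ↦ h _ (periodFunctionalK1_mem γ q)

end IntegerPoints


/-! ### Hecke operators preserve the period lattice -/

section HeckePeriods

variable {N : ℕ} [NeZero N] {n : ℕ} {p : ℕ} [NeZero p]

/-- **The translates `g ∣ βᵢ` are cusp functions of period `p`** (`g` of level `Γ₁(N)`). [cite: DiamondShurman2005, Prop. 5.2.1] -/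
theorem isCuspFunction_slash_heckeRep1 (g : CuspForm (Gamma1 N) (n + 2)) (i : Option (ZMod p)) :
    IsCuspFunction p (⇑g ∣[(n + 2 : ℤ)] intGL (heckeRep p i)) where
  pos := by exact_mod_cast NeZero.pos p
  periodic := by
    have hp0 := det_heckeRep_ne_zero (NeZero.ne p) i
    cases i with
    | none =>
      refine periodic_slash_of_upper (isCuspFunction_one_gamma1 g).periodic _
        (det_intGL_heckeRep_pos _) (intGL_heckeRep_apply_one_zero _) (m := (p : ℤ) * p) ?_
      rw [intGL_apply hp0, intGL_apply hp0]
      simp [heckeRep]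
    | some j =>
      refine periodic_slash_of_upper (isCuspFunction_one_gamma1 g).periodic _
        (det_intGL_heckeRep_pos _) (intGL_heckeRep_apply_one_zero _) (m := 1) ?_
      rw [intGL_apply hp0, intGL_apply hp0]
      simp [heckeRep]
  mdifferentiable := (ModularFormClass.holo g).slash _ _
  isZeroAtImInfty := (CuspFormClass.zero_at_infty g).slash _ (intGL_heckeRep_apply_one_zero i)

omit [NeZero N] [NeZero p] in
/-- The lower-left entry of `γ ∈ Γ₀(N)` vanishes mod `N`. [folklore] -/
theorem intCast_entry_one_zero_eq_zero (γ : Gamma0 N) :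
    (((γ : SL(2, ℤ)) 1 0 : ℤ) : ZMod N) = 0 := by
  have := γ.2
  rw [Gamma0_mem] at this
  exact_mod_cast this

/-- `T_p` commutes with the slash by `σ ∈ Γ₀(N)`: `(T_p f) ∣ σ = T_p (⟨σ⟩ f)`. [cite: DiamondShurman2005, Prop. 5.2.4(a)] -/
theorem heckeT_slash_eq (f : CuspForm (Gamma1 N) (n + 2)) (σ : Gamma0 N) :
    (⇑(heckeT (Gamma1 N) (n + 2) p f) : ℍ → ℂ) ∣[(n + 2 : ℤ)] (σ : SL(2, ℤ)) =
      ⇑(heckeT (Gamma1 N) (n + 2) p (diamondOp N (n + 2) (Gamma0Map N σ) f)) := by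
  rw [← coe_diamondOp_eq_SL_slash, ← Module.End.mul_apply,
    ← heckeT_diamondOp_comm_holds N (n + 2) p (Gamma0Map N σ), Module.End.mul_apply]

variable (hp : p.Prime)
include hp

omit [NeZero N] [NeZero p] in
/-- The twists `εᵢ` are units mod `N` (`ε_∞ = p` only occurs when `p ∤ N`). [folklore] -/
theorem isUnit_heckeEps (i : HeckeIdx N p) : IsUnit (heckeEps N p i.1) := by
  obtain ⟨_ | j, hi⟩ := i
  · exact (ZMod.isUnit_prime_iff_not_dvd hp).mpr (hi rfl)
  · exact isUnit_one

/-- **The kernel of `T_p g`**: `E(T_p g)(w, q) = ∑ᵢ E(⟨εᵢ⟩ g)(βᵢ w, βᵢ q)`. [folklore] -/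
theorem eichlerKernel_heckeT (g : CuspForm (Gamma1 N) (n + 2)) (w : ℍ) (q : Fin 2 → ℂ) :
    eichlerKernel n ⇑(heckeT (Gamma1 N) (n + 2) p g) w q =
      ∑ i : HeckeIdx N p, eichlerKernel n ⇑(diamondOp N (n + 2) (heckeEps N p i.1) g)
        (intGL (heckeRep p i.1) • w) ((zcmat (heckeRep p i.1)).mulVec q) := by
  haveI : Fact p.Prime := ⟨hp⟩
  have hp0 := det_heckeRep_ne_zero (NeZero.ne p)
  rw [coe_heckeT_gamma1 N (n + 2) p hp g, eichlerKernel_finset_sum Finset.univ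
    (fun i _ ↦ isCuspFunction_slash_heckeRep1 (diamondOp N (n + 2) (heckeEps N p i.1) g) i.1)]
  refine Finset.sum_congr rfl fun i _ ↦ ?_
  rw [(isCuspFunction_one_gamma1 _).eichlerKernel_slash_eq_of_apply_one_zero
    (det_intGL_heckeRep_pos _) (intGL_heckeRep_apply_one_zero _)
    (isCuspFunction_slash_heckeRep1 _ i.1), cmat_intGL (hp0 _)]

omit [NeZero N] [NeZero p] in
/-- **The congruence of the twists under the right action of `σ ∈ Γ₀(N)`**: if
`βᵢ σ = σ'ᵢ β_{π(i)}` then `ε_{π(i)} d(σ) = εᵢ d(σ'ᵢ)` in `ℤ/Nℤ` (`d` = lower-right entry mod `N`),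
read off from the bottom rows of the integer matrix identity `σ'ᵢ β_{π(i)} = βᵢ σ` (four cases
according as `i`, `π(i)` are finite or `∞`). [folklore] -/
theorem heckeEps_perm (σ : Gamma0 N) (i : HeckeIdx N p) :
    heckeEps N p (heckePerm hp σ i).1 * Gamma0Map N σ =
      heckeEps N p i.1 * Gamma0Map N (heckePermElt hp σ i) := by
  have hspec := heckePermElt_spec hp σ i
  set σ' : Gamma0 N := heckePermElt hp σ i
  have e10 := congrArg (fun M : Matrix (Fin 2) (Fin 2) ℤ ↦ M 1 0) hspec
  have e11 := congrArg (fun M : Matrix (Fin 2) (Fin 2) ℤ ↦ M 1 1) hspec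
  have hσ := intCast_entry_one_zero_eq_zero σ
  have hσ' := intCast_entry_one_zero_eq_zero σ'
  -- `Gamma0Map` is the lower-right entry mod `N` (by definition)
  change heckeEps N p (heckePerm hp σ i).1 * (((σ : SL(2, ℤ)) 1 1 : ℤ) : ZMod N) =
    heckeEps N p i.1 * (((σ' : SL(2, ℤ)) 1 1 : ℤ) : ZMod N)
  obtain ⟨_ | j, hi⟩ := i <;> rcases hπ : (heckePerm hp σ _).1 with _ | j' <;>
    simp only [hπ, heckeRep, Matrix.mul_apply, Fin.sum_univ_two, Matrix.of_apply, Matrix.cons_val',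
      Matrix.cons_val_zero, Matrix.cons_val_one, Matrix.empty_val', Matrix.cons_val_fin_one,
      heckeEps, mul_zero, zero_mul, mul_one, one_mul, add_zero, zero_add] at e10 e11 ⊢
  · -- (∞, ∞)
    have := congrArg (Int.cast : ℤ → ZMod N) e11
    rw [this]
  · -- (∞, j')
    have := congrArg (Int.cast : ℤ → ZMod N) e11
    push_cast at this ⊢
    linear_combination -this + (j'.val : ZMod N) * hσ'
  · -- (j, ∞)
    have := congrArg (Int.cast : ℤ → ZMod N) e11
    push_cast at this ⊢
    linear_combination -this
  · -- (j, j')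
    have hp0 : (p : ℤ) ≠ 0 := by exact_mod_cast hp.ne_zero
    have hint : ((σ' : SL(2, ℤ)) 1 1 : ℤ) =
        ((σ : SL(2, ℤ)) 1 1 : ℤ) - ((σ : SL(2, ℤ)) 1 0 : ℤ) * j'.val := by
      apply mul_left_cancel₀ hp0
      linear_combination e11 - (j'.val : ℤ) * e10
    have := congrArg (Int.cast : ℤ → ZMod N) hint
    push_cast at this ⊢
    linear_combination -this + (j'.val : ZMod N) * hσ

/-- The kernel at the permuted point: `E(g)(βᵢ σ w, βᵢ σ q) = E(⟨σ'ᵢ⟩ g)(β_{π(i)} w, β_{π(i)} q) - c_g(σ'ᵢ)(β_{π(i)} q)`. [folklore] -/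
theorem eichlerKernel_heckeRep_perm (g : CuspForm (Gamma1 N) (n + 2)) (σ : Gamma0 N)
    (i : HeckeIdx N p) (w : ℍ) (q : Fin 2 → ℂ) :
    eichlerKernel n ⇑g (intGL (heckeRep p i.1) • (σ : SL(2, ℤ)) • w)
        ((zcmat (heckeRep p i.1)).mulVec ((icmat σ).mulVec q)) =
      eichlerKernel n ⇑(diamondOp N (n + 2) (Gamma0Map N (heckePermElt hp σ i)) g)
          (intGL (heckeRep p (heckePerm hp σ i).1) • w)
          ((zcmat (heckeRep p (heckePerm hp σ i).1)).mulVec q) -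
        periodFn1 n g (heckePermElt hp σ i)
          ((zcmat (heckeRep p (heckePerm hp σ i).1)).mulVec q) := by
  rw [periodFn1_eq g (heckePermElt hp σ i : SL(2, ℤ)) _
      (intGL (heckeRep p (heckePerm hp σ i).1) • w),
    ← coe_diamondOp_eq_SL_slash, sub_sub_cancel, ModularGroup.sl_moeb, ModularGroup.sl_moeb,
    ← mul_smul, ← mul_smul, intGL_heckeRep_mul, Matrix.mulVec_mulVec, Matrix.mulVec_mulVec,
    icmat_eq_zcmat, icmat_eq_zcmat, ← zcmat_mul, ← zcmat_mul, ← heckePermElt_spec hp σ i]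

/-- **Hecke operators on the period cocycle** (Shimura's (8.3.2) at level `Γ₁(N)`):
`c_{T_p f}(σ)(q) = ∑ᵢ c_{⟨εᵢ⟩ f}(σ'ᵢ)(β_{π(i)} q)` for `σ ∈ Γ₀(N)`. [cite: Shimura1971, §8.3 (8.3.2) and Prop. 8.5] -/
theorem periodFn1_heckeT (f : CuspForm (Gamma1 N) (n + 2)) (σ : Gamma0 N) (q : Fin 2 → ℂ) :
    periodFn1 n (heckeT (Gamma1 N) (n + 2) p f) σ q =
      ∑ i : HeckeIdx N p, periodFn1 n (diamondOp N (n + 2) (heckeEps N p i.1) f)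
        (heckePermElt hp σ i) ((zcmat (heckeRep p (heckePerm hp σ i).1)).mulVec q) := by
  haveI : Fact p.Prime := ⟨hp⟩
  set τ : ℍ := UpperHalfPlane.I
  have hAB : (∑ i : HeckeIdx N p, eichlerKernel n
      ⇑(diamondOp N (n + 2) (heckeEps N p i.1) (diamondOp N (n + 2) (Gamma0Map N σ) f))
        (intGL (heckeRep p i.1) • τ) ((zcmat (heckeRep p i.1)).mulVec q)) =
      ∑ i : HeckeIdx N p, eichlerKernel n
        ⇑(diamondOp N (n + 2) (Gamma0Map N (heckePermElt hp σ i))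
          (diamondOp N (n + 2) (heckeEps N p i.1) f))
        (intGL (heckeRep p (heckePerm hp σ i).1) • τ)
        ((zcmat (heckeRep p (heckePerm hp σ i).1)).mulVec q) := by
    refine (Fintype.sum_equiv (heckePermEquiv hp σ) _ _ fun i ↦ ?_).symm
    simp only [heckePermEquiv_apply]
    congr 2
    rw [← Module.End.mul_apply, ← diamondOp_mul_holds N (n + 2)
        (isUnit_Gamma0Map N (heckePermElt hp σ i)) (isUnit_heckeEps hp i),
      ← Module.End.mul_apply, ← diamondOp_mul_holds N (n + 2) (isUnit_heckeEps hp _)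
        (isUnit_Gamma0Map N σ), heckeEps_perm hp σ i, mul_comm]
  rw [periodFn1_eq _ (σ : SL(2, ℤ)) q τ, heckeT_slash_eq, eichlerKernel_heckeT hp,
    eichlerKernel_heckeT hp]
  simp_rw [eichlerKernel_heckeRep_perm hp]
  rw [Finset.sum_sub_distrib, hAB]
  ring

/-- **Hecke operators on the period functionals**:
`T_p^∨ λ_{σ,q} = ∑ᵢ ⟨εᵢ⟩^∨ λ_{σ'ᵢ, β_{π(i)} q}` — an integral combination of diamond-twisted
period functionals. [cite: Shimura1971, §8.3 (8.3.2) and Prop. 8.5] -/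
theorem dualMap_heckeT_periodFunctionalK1 (σ : Gamma0 N) (q : Fin 2 → ℤ) :
    (heckeT (Gamma1 N) (n + 2) p).dualMap (periodFunctionalK1 n σ q) =
      ∑ i : HeckeIdx N p, (diamondOp N (n + 2) (heckeEps N p i.1)).dualMap
        (periodFunctionalK1 n (heckePermElt hp σ i)
          ((heckeRep p (heckePerm hp σ i).1).mulVec q)) := by
  haveI : Fact p.Prime := ⟨hp⟩
  ext f
  simp only [LinearMap.dualMap_apply, periodFunctionalK1_apply, LinearMap.coe_sum,
    Finset.sum_apply]
  rw [periodFn1_heckeT hp]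
  refine Finset.sum_congr rfl fun i _ ↦ ?_
  rw [zcmat_mulVec_intCast]

/-- **The Hecke operators `T_p^∨` preserve the Eichler–Shimura period lattice of `S_{n+2}(Γ₁(N))`.** [cite: Shimura1971, §8.4 p. 240 (ΓαΓ is stable on H¹_P(Γ, D))] -/
theorem dualMap_heckeT_mem_periodLatticeK1 {φ : Module.Dual ℂ (CuspForm (Gamma1 N) (n + 2))}
    (hφ : φ ∈ periodLatticeK1 (N := N) n) :
    (heckeT (Gamma1 N) (n + 2) p).dualMap φ ∈ periodLatticeK1 (N := N) n := by
  haveI : Fact p.Prime := ⟨hp⟩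
  induction hφ using AddSubgroup.closure_induction with
  | mem x hx =>
    obtain ⟨⟨σ, q⟩, rfl⟩ := hx
    rw [dualMap_heckeT_periodFunctionalK1 hp]
    exact AddSubgroup.sum_mem _ fun i _ ↦
      dualMap_diamondOp_mem_periodLatticeK1 _ (periodFunctionalK1_mem _ _)
  | zero => simp [zero_mem]
  | add x y _ _ hx hy => rw [map_add]; exact add_mem hx hy
  | neg x _ hx => rw [map_neg]; exact neg_mem hx

end HeckePeriods

/-! ### Summary -/

section Summary

variable (N : ℕ) [NeZero N] (n : ℕ)

/-- **The Eichler–Shimura period lattice of `S_{n+2}(Γ₁(N))`** is a finitely generated subgroup of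
the dual space, stable under the transposes `T_p^∨` of all Hecke operators `T_p` (`p` prime) and
`⟨d⟩^∨` of all diamond operators, and separating the points of `S_{n+2}(Γ₁(N))`. This is the
structure behind Shimura 1971, (3.5.20) for `Γ' = Γ₁(N)` (proved there in §8.4 from Thm. 8.4,
Prop. 8.5, Prop. 8.6). [cite: Shimura1971, (3.5.20) p. 84 and §8.4 pp. 239–241] -/
theorem periodLatticeK1_fg_stable_separating :
    (periodLatticeK1 (N := N) n).FG ∧
    (∀ (p : ℕ) (hp : p.Prime), ∀ φ ∈ periodLatticeK1 (N := N) n,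
      (haveI : NeZero p := ⟨hp.ne_zero⟩; (heckeT (Gamma1 N) (n + 2) p).dualMap φ) ∈
        periodLatticeK1 (N := N) n) ∧
    (∀ d : ZMod N, ∀ φ ∈ periodLatticeK1 (N := N) n,
      (diamondOp N (n + 2) d).dualMap φ ∈ periodLatticeK1 (N := N) n) ∧
    ∀ f : CuspForm (Gamma1 N) (n + 2), (∀ φ ∈ periodLatticeK1 (N := N) n, φ f = 0) → f = 0 := by
  refine ⟨periodLatticeK1_fg N n, fun p hp φ hφ ↦ ?_,
    fun d φ hφ ↦ dualMap_diamondOp_mem_periodLatticeK1 d hφ,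
    fun f hf ↦ eq_zero_of_forall_mem_periodLatticeK1 f hf⟩
  haveI : NeZero p := ⟨hp.ne_zero⟩
  exact dualMap_heckeT_mem_periodLatticeK1 hp hφ

end Summary

end Literature.NumberTheory.EllipticCurves.ModularForms
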